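import Mathlib
import HarnessLib
import Literature.Computability.AlgebraicComplexity.HessianRank
import Summits.PneNP.PneNP.Theorems.CnfIdealGenLengthRankDefectRepresentationsCutLemmaCharacterCuts

/-!
# Crux `RankDefectRepresentations` (stmt-PneNP-18923), line `rank-dehn-ladder`, stub `stub_cutLemma`: the RANK-ONE regime

The cut lemma (negative rung N1) in its conjectured sharp ADDITIVE form says `rank (R ∘ 1[row ≠ col]) ≤ Σ_j rank X_j` for the
coordinate cuts `X_j = R ∘ 1[row_j ≠ col_j]`.  This file PROVES it when every cut has rank `≤ 1`:

* `rank_offColour_le_sum_rank` — if every `X_j` has rank `≤ 1` then `rank (R ∘ 1[row ≠ col]) ≤ Σ_j rank X_j` (sharp: `n`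
  entries differing in one coordinate each attain it);
* `cutLemma_rank_le_one` — the registered conclusion of `stub_cutLemma` for `t ≤ 1`, with `C = a = 1`.

IDEA (dominance induction).  A cut of rank `≤ 1` cannot have non-zero entries in BOTH of its blocks
`{row_j = 0, col_j = 1}`, `{row_j = 1, col_j = 0}` (`antidiag_dichotomy`, a vanishing `2 × 2` minor).  Split rows and columns by
the last colour bit: one anti-diagonal block of `R ∘ 1[row ≠ col]` vanishes, the other is (a mask of) the last cut, and the two
diagonal blocks are instances on `n − 1` coordinates whose cuts are masks of the old cuts; finally NO old cut restricts
non-trivially to both diagonal blocks (`rank_restrict_add_le`: by the `2 × 2` minor again it would have non-zero entries in both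
anti-diagonal blocks, contradicting the dichotomy for the last cut).  So the sum of cut ranks splits across the two diagonal
instances and the induction closes with no loss.  For cuts of rank `≥ 2` this "straddling" can occur — that is exactly where the
general cut lemma is open.
HONEST FRAMING: a partial result toward one rung; the cut lemma, the crux, GL_noncomm and P ≠ NP are NOT touched; F-N2 is a
FRONTIER formal rung.
-/

set_option linter.dupNamespace false -- `Summit.PneNP.PneNP.…`: summit = sub-problem name (D-0017)

namespace Summit.PneNP.PneNP.Theorems.CnfIdealGenLengthRankDefectRepresentationsCutLemmaRankOneCuts

open Summit.PneNP.PneNP.Theorems.CnfIdealGenLengthRankDefectRepresentationsCutLemmaCharacterCuts (rank_submatrix_le')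
open Literature.Computability.AlgebraicComplexity (rank_add_le)

variable {K : Type} [Field K] {ι ι' : Type} [Fintype ι] [Fintype ι'] [DecidableEq ι] [DecidableEq ι']

/-! ## Matrix facts -/

/-- A `2 × 2` minor of a matrix of rank `≤ 1` vanishes. [folklore] -/
theorem minor_eq_zero_of_rank_le_one (X : Matrix ι ι' K) (hX : X.rank ≤ 1) (a a' : ι) (b b' : ι') :
    X a b * X a' b' - X a b' * X a' b = 0 := by
  by_contra hne
  have hdet : (X.submatrix ![a, a'] ![b, b']).det = X a b * X a' b' - X a b' * X a' b := by
    rw [Matrix.det_fin_two]; simp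
  have hunit : IsUnit (X.submatrix ![a, a'] ![b, b']) :=
    (Matrix.isUnit_iff_isUnit_det _).mpr (isUnit_iff_ne_zero.mpr (hdet ▸ hne))
  have h2 : (X.submatrix ![a, a'] ![b, b']).rank = 2 := by
    rw [Matrix.rank_of_isUnit _ hunit, Fintype.card_fin]
  have h1 := (rank_submatrix_le' X ![a, a'] ![b, b']).trans hX
  omega

/-- Masking rows and columns does not increase the rank. [folklore] -/
theorem rank_mask_le (A : Matrix ι ι' K) (P : ι → Prop) (Q : ι' → Prop) [DecidablePred P] [DecidablePred Q] :
    (Matrix.of fun x y => if P x ∧ Q y then A x y else 0).rank ≤ A.rank := by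
  have h : (Matrix.of fun x y => if P x ∧ Q y then A x y else 0) =
      Matrix.diagonal (fun x => if P x then (1 : K) else 0) * A * Matrix.diagonal (fun y => if Q y then (1 : K) else 0) := by
    ext x y
    simp only [Matrix.of_apply, Matrix.mul_diagonal, Matrix.diagonal_mul]
    by_cases hP : P x <;> by_cases hQ : Q y <;> simp [hP, hQ]
  rw [h]
  exact (Matrix.rank_mul_le_left _ _).trans (Matrix.rank_mul_le_right _ _)

omit [Fintype ι] [Fintype ι'] [DecidableEq ι] [DecidableEq ι'] in
/-- A non-zero matrix has a non-zero entry. [folklore] -/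
theorem exists_entry_ne_zero {A : Matrix ι ι' K} (h : A ≠ 0) : ∃ x y, A x y ≠ 0 := by
  by_contra hc
  apply h
  ext x y
  by_contra hxy
  exact hc ⟨x, y, hxy⟩

omit [Fintype ι] [Fintype ι'] [DecidableEq ι] [DecidableEq ι'] in
/-- A non-zero entry of a masked cut: a pair inside the mask, differing in the coordinate, with `R ≠ 0`. [folklore] -/
theorem entry_of_maskedCut_ne_zero {m : ℕ} (row : ι → Fin m → Bool) (col : ι' → Fin m → Bool) (R : Matrix ι ι' K)
    (P : ι → Prop) (Q : ι' → Prop) [DecidablePred P] [DecidablePred Q] (j : Fin m)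
    (h : (Matrix.of fun x y => if P x ∧ Q y then
      (Matrix.of fun x y => if row x j ≠ col y j then R x y else 0 : Matrix ι ι' K) x y else 0) ≠ 0) :
    ∃ a b, P a ∧ Q b ∧ row a j ≠ col b j ∧ R a b ≠ 0 := by
  obtain ⟨a, b, hab⟩ := exists_entry_ne_zero h
  simp only [Matrix.of_apply] at hab
  by_cases hPQ : P a ∧ Q b
  · rw [if_pos hPQ] at hab
    by_cases hc : row a j ≠ col b j
    · rw [if_pos hc] at hab; exact ⟨a, b, hPQ.1, hPQ.2, hc, hab⟩
    · rw [if_neg hc] at hab; exact absurd rfl hab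
  · rw [if_neg hPQ] at hab; exact absurd rfl hab

/-! ## Cuts of rank `≤ 1` -/

/-- **No crossing.** If the cut along `j` has rank `≤ 1`, it cannot have a non-zero entry with `(row_j, col_j) = (0, 1)` AND
one with `(row_j, col_j) = (1, 0)` (the `2 × 2` minor through them would be `− R a b' · R a' b ≠ 0`). [folklore] -/
theorem cross_contra {m : ℕ} (row : ι → Fin m → Bool) (col : ι' → Fin m → Bool) (R : Matrix ι ι' K) (j : Fin m)
    (hX : (Matrix.of fun x y => if row x j ≠ col y j then R x y else 0).rank ≤ 1) {a a' : ι} {b b' : ι'}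
    (ha : row a j = false) (hb' : col b' j = true) (ha' : row a' j = true) (hb : col b j = false)
    (h1 : R a b' ≠ 0) (h2 : R a' b ≠ 0) : False := by
  have hmin := minor_eq_zero_of_rank_le_one _ hX a a' b b'
  simp only [Matrix.of_apply, ha, hb, ha', hb'] at hmin
  simp at hmin
  rcases hmin with h | h
  · exact h1 h
  · exact h2 h

/-- **Dichotomy of the anti-diagonal blocks** of a rank-`≤ 1` cut: `R` vanishes on all pairs with `(row_j, col_j) = (0,1)`, or
on all pairs with `(row_j, col_j) = (1,0)`. [folklore] -/
theorem antidiag_dichotomy {m : ℕ} (row : ι → Fin m → Bool) (col : ι' → Fin m → Bool) (R : Matrix ι ι' K) (j : Fin m)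
    (hX : (Matrix.of fun x y => if row x j ≠ col y j then R x y else 0).rank ≤ 1) :
    (∀ x y, row x j = false → col y j = true → R x y = 0) ∨ (∀ x y, row x j = true → col y j = false → R x y = 0) := by
  rcases Classical.em (∀ x y, row x j = false → col y j = true → R x y = 0) with h | h
  · exact Or.inl h
  · right
    intro x' y' hx' hy'
    by_contra hne'
    apply h
    intro x y hx hy
    by_contra hne
    exact cross_contra row col R j hX hx hy hx' hy' hne hne'

/-! ## Splitting by the last coordinate -/

section Split

variable {n : ℕ} (row : ι → Fin (n + 1) → Bool) (col : ι' → Fin (n + 1) → Bool) (R : Matrix ι ι' K)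

omit [Fintype ι] [Fintype ι'] [DecidableEq ι] [DecidableEq ι'] in
/-- The four blocks by the last colour bit. [folklore] -/
theorem fourBlocks_eq (F : Matrix ι ι' K) :
    F = (Matrix.of fun x y => if row x (Fin.last n) = false ∧ col y (Fin.last n) = false then F x y else 0) +
        (Matrix.of fun x y => if row x (Fin.last n) = true ∧ col y (Fin.last n) = true then F x y else 0) +
        ((Matrix.of fun x y => if row x (Fin.last n) = false ∧ col y (Fin.last n) = true then F x y else 0) +
          (Matrix.of fun x y => if row x (Fin.last n) = true ∧ col y (Fin.last n) = false then F x y else 0)) := by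
  ext x y
  simp only [Matrix.add_apply, Matrix.of_apply]
  cases row x (Fin.last n) <;> cases col y (Fin.last n) <;> simp

omit [Fintype ι] [Fintype ι'] [DecidableEq ι] [DecidableEq ι'] in
/-- A diagonal block of the off-colour part is the off-colour part of an instance on the first `n` coordinates. [folklore] -/
theorem diagBlock_eq (β : Bool) :
    (Matrix.of fun x y => if row x (Fin.last n) = β ∧ col y (Fin.last n) = β then
        (Matrix.of fun x y => if row x ≠ col y then R x y else 0 : Matrix ι ι' K) x y else 0) =
      Matrix.of fun x y => if (fun j : Fin n => row x j.castSucc) ≠ (fun j : Fin n => col y j.castSucc) then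
        (Matrix.of fun x y => if row x (Fin.last n) = β ∧ col y (Fin.last n) = β then R x y else 0 : Matrix ι ι' K) x y
        else 0 := by
  ext x y
  simp only [Matrix.of_apply]
  by_cases h : row x (Fin.last n) = β ∧ col y (Fin.last n) = β
  · have hiff : row x ≠ col y ↔ (fun j : Fin n => row x j.castSucc) ≠ (fun j : Fin n => col y j.castSucc) := by
      rw [not_iff_not]
      constructor
      · intro h'; funext j; exact congrFun h' j.castSucc
      · intro h'; funext j
        refine Fin.lastCases ?_ (fun i => ?_) j
        · exact h.1.trans h.2.symm
        · exact congrFun h' i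
    rw [if_pos h]
    by_cases hne : row x ≠ col y
    · rw [if_pos hne, if_pos (hiff.mp hne), if_pos h]
    · rw [if_neg hne, if_neg (fun h' => hne (hiff.mpr h'))]
  · rw [if_neg h]
    by_cases hne : (fun j : Fin n => row x j.castSucc) ≠ (fun j : Fin n => col y j.castSucc)
    · rw [if_pos hne, if_neg h]
    · rw [if_neg hne]

omit [Fintype ι] [Fintype ι'] [DecidableEq ι] [DecidableEq ι'] in
/-- An anti-diagonal block of the off-colour part is the corresponding block of the last cut. [folklore] -/
theorem antiBlock_eq (β β' : Bool) (hβ : β ≠ β') :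
    (Matrix.of fun x y => if row x (Fin.last n) = β ∧ col y (Fin.last n) = β' then
        (Matrix.of fun x y => if row x ≠ col y then R x y else 0 : Matrix ι ι' K) x y else 0) =
      Matrix.of fun x y => if row x (Fin.last n) = β ∧ col y (Fin.last n) = β' then
        (Matrix.of fun x y => if row x (Fin.last n) ≠ col y (Fin.last n) then R x y else 0 : Matrix ι ι' K) x y else 0 := by
  ext x y
  simp only [Matrix.of_apply]
  by_cases h : row x (Fin.last n) = β ∧ col y (Fin.last n) = β'
  · have hne : row x (Fin.last n) ≠ col y (Fin.last n) := by rw [h.1, h.2]; exact hβ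
    rw [if_pos h, if_pos h, if_pos hne, if_pos (fun heq => hne (congrFun heq _))]
  · rw [if_neg h, if_neg h]

omit [Fintype ι] [Fintype ι'] [DecidableEq ι] [DecidableEq ι'] in
/-- The cuts of a restricted instance are masks of the old cuts. [folklore] -/
theorem cut_restrict_eq (β : Bool) (j : Fin n) :
    (Matrix.of fun x y => if row x j.castSucc ≠ col y j.castSucc then
        (Matrix.of fun x y => if row x (Fin.last n) = β ∧ col y (Fin.last n) = β then R x y else 0 : Matrix ι ι' K) x y
        else 0) =
      Matrix.of fun x y => if row x (Fin.last n) = β ∧ col y (Fin.last n) = β then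
        (Matrix.of fun x y => if row x j.castSucc ≠ col y j.castSucc then R x y else 0 : Matrix ι ι' K) x y else 0 := by
  ext x y
  simp only [Matrix.of_apply]
  split_ifs <;> rfl

/-- **No straddling.** If all cuts have rank `≤ 1`, an old cut restricts non-trivially to at most one of the two diagonal
blocks, so the restricted cut ranks add up to at most the old cut rank. [folklore] -/
theorem rank_restrict_add_le
    (hX : ∀ j, (Matrix.of fun x y => if row x j ≠ col y j then R x y else 0).rank ≤ 1) (j : Fin n) :
    (Matrix.of fun x y => if row x (Fin.last n) = false ∧ col y (Fin.last n) = false then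
        (Matrix.of fun x y => if row x j.castSucc ≠ col y j.castSucc then R x y else 0 : Matrix ι ι' K) x y else 0).rank +
    (Matrix.of fun x y => if row x (Fin.last n) = true ∧ col y (Fin.last n) = true then
        (Matrix.of fun x y => if row x j.castSucc ≠ col y j.castSucc then R x y else 0 : Matrix ι ι' K) x y else 0).rank ≤
    (Matrix.of fun x y => if row x j.castSucc ≠ col y j.castSucc then R x y else 0).rank := by
  by_cases h0 : (Matrix.of fun x y => if row x (Fin.last n) = false ∧ col y (Fin.last n) = false then
      (Matrix.of fun x y => if row x j.castSucc ≠ col y j.castSucc then R x y else 0 : Matrix ι ι' K) x y else 0) = 0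
  · rw [h0, Matrix.rank_zero, zero_add]; exact rank_mask_le _ _ _
  by_cases h1 : (Matrix.of fun x y => if row x (Fin.last n) = true ∧ col y (Fin.last n) = true then
      (Matrix.of fun x y => if row x j.castSucc ≠ col y j.castSucc then R x y else 0 : Matrix ι ι' K) x y else 0) = 0
  · rw [h1, Matrix.rank_zero, add_zero]; exact rank_mask_le _ _ _
  exfalso
  obtain ⟨a, b, ha, hb, hab, hRab⟩ := entry_of_maskedCut_ne_zero row col R _ _ j.castSucc h0
  obtain ⟨a', b', ha', hb', hab', hRab'⟩ := entry_of_maskedCut_ne_zero row col R _ _ j.castSucc h1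
  have hmin := minor_eq_zero_of_rank_le_one _ (hX j.castSucc) a a' b b'
  have hprod : (Matrix.of fun x y => if row x j.castSucc ≠ col y j.castSucc then R x y else 0 : Matrix ι ι' K) a b' *
      (Matrix.of fun x y => if row x j.castSucc ≠ col y j.castSucc then R x y else 0 : Matrix ι ι' K) a' b ≠ 0 := by
    intro hz
    rw [hz, sub_zero] at hmin
    simp only [Matrix.of_apply, if_pos hab, if_pos hab'] at hmin
    exact mul_ne_zero hRab hRab' hmin
  have hR1 : R a b' ≠ 0 := by
    intro hz; apply hprod; simp [hz]
  have hR2 : R a' b ≠ 0 := by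
    intro hz; apply hprod; simp [hz]
  rcases antidiag_dichotomy row col R (Fin.last n) (hX (Fin.last n)) with h | h
  · exact hR1 (h a b' ha hb')
  · exact hR2 (h a' b ha' hb)

/-- The anti-diagonal blocks together have rank at most that of the last cut (one of them vanishes). [folklore] -/
theorem rank_antiBlocks_le
    (hX : (Matrix.of fun x y => if row x (Fin.last n) ≠ col y (Fin.last n) then R x y else 0).rank ≤ 1) :
    ((Matrix.of fun x y => if row x (Fin.last n) = false ∧ col y (Fin.last n) = true then
        (Matrix.of fun x y => if row x ≠ col y then R x y else 0 : Matrix ι ι' K) x y else 0) +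
      (Matrix.of fun x y => if row x (Fin.last n) = true ∧ col y (Fin.last n) = false then
        (Matrix.of fun x y => if row x ≠ col y then R x y else 0 : Matrix ι ι' K) x y else 0)).rank ≤
    (Matrix.of fun x y => if row x (Fin.last n) ≠ col y (Fin.last n) then R x y else 0).rank := by
  rw [antiBlock_eq row col R false true (by decide), antiBlock_eq row col R true false (by decide)]
  rcases antidiag_dichotomy row col R (Fin.last n) hX with h | h
  · have h0 : (Matrix.of fun x y => if row x (Fin.last n) = false ∧ col y (Fin.last n) = true then
        (Matrix.of fun x y => if row x (Fin.last n) ≠ col y (Fin.last n) then R x y else 0 : Matrix ι ι' K) x y else 0) = 0 := by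
      ext x y
      simp only [Matrix.of_apply, Matrix.zero_apply]
      split_ifs with hc
      · exact h x y hc.1 hc.2
      · rfl
      · rfl
    rw [h0, zero_add]; exact rank_mask_le _ _ _
  · have h0 : (Matrix.of fun x y => if row x (Fin.last n) = true ∧ col y (Fin.last n) = false then
        (Matrix.of fun x y => if row x (Fin.last n) ≠ col y (Fin.last n) then R x y else 0 : Matrix ι ι' K) x y else 0) = 0 := by
      ext x y
      simp only [Matrix.of_apply, Matrix.zero_apply]
      split_ifs with hc
      · exact h x y hc.1 hc.2
      · rfl
      · rfl
    rw [h0, add_zero]; exact rank_mask_le _ _ _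

end Split

/-! ## The rank-one cut lemma -/

/-- **Rank-one cut lemma (additive form).** If every coordinate cut `X_j = R ∘ 1[row_j ≠ col_j]` has rank `≤ 1`, then
`rank (R ∘ 1[row ≠ col]) ≤ Σ_j rank X_j`. [folklore] -/
theorem rank_offColour_le_sum_rank :
    ∀ (n : ℕ) (row : ι → Fin n → Bool) (col : ι' → Fin n → Bool) (R : Matrix ι ι' K),
      (∀ j, (Matrix.of fun x y => if row x j ≠ col y j then R x y else 0).rank ≤ 1) →
      (Matrix.of fun x y => if row x ≠ col y then R x y else 0).rank ≤
        ∑ j : Fin n, (Matrix.of fun x y => if row x j ≠ col y j then R x y else 0).rank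
  | 0, row, col, R, _ => by
      have h0 : (Matrix.of fun x y => if row x ≠ col y then R x y else 0) = 0 := by
        ext x y
        have : row x = col y := funext fun j => j.elim0
        simp [this]
      rw [h0, Matrix.rank_zero]
      exact Nat.zero_le _
  | n + 1, row, col, R, hX => by
      -- cuts of the two restricted instances have rank ≤ 1
      have hX' : ∀ (β : Bool) (j : Fin n),
          (Matrix.of fun x y => if (fun j : Fin n => row x j.castSucc) j ≠ (fun j : Fin n => col y j.castSucc) j then
            (Matrix.of fun x y => if row x (Fin.last n) = β ∧ col y (Fin.last n) = β then R x y else 0 : Matrix ι ι' K) x y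
            else 0).rank ≤ 1 := by
        intro β j
        show (Matrix.of fun x y => if row x j.castSucc ≠ col y j.castSucc then
            (Matrix.of fun x y => if row x (Fin.last n) = β ∧ col y (Fin.last n) = β then R x y else 0 : Matrix ι ι' K) x y
            else 0).rank ≤ 1
        rw [cut_restrict_eq]
        exact (rank_mask_le _ _ _).trans (hX j.castSucc)
      -- induction hypothesis on the two diagonal blocks
      have IH : ∀ β : Bool,
          (Matrix.of fun x y => if row x (Fin.last n) = β ∧ col y (Fin.last n) = β then
            (Matrix.of fun x y => if row x ≠ col y then R x y else 0 : Matrix ι ι' K) x y else 0).rank ≤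
          ∑ j : Fin n, (Matrix.of fun x y => if row x (Fin.last n) = β ∧ col y (Fin.last n) = β then
            (Matrix.of fun x y => if row x j.castSucc ≠ col y j.castSucc then R x y else 0 : Matrix ι ι' K) x y else 0).rank := by
        intro β
        rw [diagBlock_eq]
        refine (rank_offColour_le_sum_rank n (fun x j => row x j.castSucc) (fun y j => col y j.castSucc) _ (hX' β)).trans
          (le_of_eq (Finset.sum_congr rfl fun j _ => ?_))
        show (Matrix.of fun x y => if row x j.castSucc ≠ col y j.castSucc then
            (Matrix.of fun x y => if row x (Fin.last n) = β ∧ col y (Fin.last n) = β then R x y else 0 : Matrix ι ι' K) x y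
            else 0).rank = _
        rw [cut_restrict_eq]
      -- assemble
      rw [fourBlocks_eq row col (Matrix.of fun x y => if row x ≠ col y then R x y else 0)]
      refine (rank_add_le _ _).trans ?_
      refine (Nat.add_le_add ((rank_add_le _ _).trans (Nat.add_le_add (IH false) (IH true)))
        (rank_antiBlocks_le row col R (hX (Fin.last n)))).trans ?_
      rw [Fin.sum_univ_castSucc, ← Finset.sum_add_distrib]
      exact Nat.add_le_add_right (Finset.sum_le_sum fun j _ => rank_restrict_add_le row col R hX j) _

/-- The off-colour part has rank at most `n` when all cuts have rank `≤ 1`. [folklore] -/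
theorem rank_offColour_le {n : ℕ} (row : ι → Fin n → Bool) (col : ι' → Fin n → Bool) (R : Matrix ι ι' K)
    (hX : ∀ j, (Matrix.of fun x y => if row x j ≠ col y j then R x y else 0).rank ≤ 1) :
    (Matrix.of fun x y => if row x ≠ col y then R x y else 0).rank ≤ n := by
  refine (rank_offColour_le_sum_rank n row col R hX).trans ?_
  calc ∑ j : Fin n, (Matrix.of fun x y => if row x j ≠ col y j then R x y else 0).rank
      ≤ ∑ _j : Fin n, 1 := Finset.sum_le_sum fun j _ => hX j
    _ = n := by simp

/-- **`stub_cutLemma` in the rank-one regime.** For `t ≤ 1` the registered conclusion of the cut lemma holds with `C = a = 1`: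
there is an `R'` supported on equal-colour pairs with `rank (R − R') ≤ 1 · (n + 1) ^ 1 · t`. [folklore] -/
theorem cutLemma_rank_le_one {n : ℕ} (row : ι → Fin n → Bool) (col : ι' → Fin n → Bool) (t : ℕ) (ht : t ≤ 1)
    (R : Matrix ι ι' K) (hX : ∀ j : Fin n, (Matrix.of fun x y => if row x j ≠ col y j then R x y else 0).rank ≤ t) :
    ∃ R' : Matrix ι ι' K, (∀ x y, row x ≠ col y → R' x y = 0) ∧ (R - R').rank ≤ 1 * (n + 1) ^ 1 * t := by
  refine ⟨Matrix.of fun x y => if row x = col y then R x y else 0, fun x y h => by simp [h], ?_⟩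
  have hRR' : R - (Matrix.of fun x y => if row x = col y then R x y else 0) =
      Matrix.of fun x y => if row x ≠ col y then R x y else 0 := by
    ext x y
    simp only [Matrix.sub_apply, Matrix.of_apply]
    by_cases h : row x = col y <;> simp [h]
  rw [hRR']
  refine (rank_offColour_le_sum_rank n row col R fun j => (hX j).trans ht).trans ?_
  calc ∑ j : Fin n, (Matrix.of fun x y => if row x j ≠ col y j then R x y else 0).rank
      ≤ ∑ _j : Fin n, t := Finset.sum_le_sum fun j _ => hX j
    _ = n * t := by simp
    _ ≤ 1 * (n + 1) ^ 1 * t := by rw [one_mul, pow_one]; exact Nat.mul_le_mul_right t (Nat.le_succ n)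

end Summit.PneNP.PneNP.Theorems.CnfIdealGenLengthRankDefectRepresentationsCutLemmaRankOneCuts
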